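import Mathlib

/-!
# Shape diversity of near-apex ladders — one-injection (Mathlib API) proof

Support file for item `stmt-MatrixMultiplication-14308` (`FourierTwoFamiliesModP.PrimeTwoFamilies`,
CKSU 2005 Conj. 4.7 with prime cyclic hosts), line `Sketch`, registered stub
`ladder_rpow_le_rightShapes` (siege k1, variation "Mathlib API route"; an independent proof of the
statement landed in namespace `…Theorems.PrimeTwoFamilies.LadderLift`).

A LADDER in an abelian group `G` is a family of `r` classes `(X c, Y c)`, `c : Fin r`, with

* (`hW`) every class direct: `(x - x') + (y - y') = 0` with `x, x' ∈ X c`, `y, y' ∈ Y c` forces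
  `x = x'` and `y = y'`;
* (`hL`) for classes `p < q` every cross difference `y' - x'` (`x' ∈ X p`, `y' ∈ Y q`) avoids every
  diagonal difference `y - x` (`x ∈ X c`, `y ∈ Y c`, any class `c`).

SUB-TEMPLATES.  `K` patterns `Y₀ : Fin K → Finset G` and an assignment `κ : Fin r → Fin K` such that
a translate of the assigned pattern sits inside each `Y`-side: `u c +ᵥ Y₀ (κ c) ⊆ Y c`.

THE COUNT (`sum_card_mul_card_subtemplate_le`).  The single map `(c, x, y₀) ↦ (κ c, y₀ - x)` is
injective on `Σ_c X c ×ˢ Y₀ (κ c)` with values in `Fin K × G` (`Finset.card_le_card_of_injOn`):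
a collision inside one fibre of `κ`, `y₀ - x = y₀' - x'` with `x ∈ X c`, `x' ∈ X c'`,
`κ c = κ c'`, translated by `u` of the LARGER class reads as a diagonal difference of that class
equal to a cross difference — excluded by `hL` when `c ≠ c'` — and for `c = c'` it is
`(x' - x) + ((u c + y₀) - (u c + y₀')) = 0`, so directness `hW` gives `x = x'`, `y₀ = y₀'`.
Hence `Σ_c |X c|·|Y₀ (κ c)| ≤ K·|G|`.

THE STUB (`ladder_rpow_le_rightShapes`).  When the `Y`-sides ARE the translates
(`Y c = u c +ᵥ Y₀ (κ c)`, so `|Y c| = |Y₀ (κ c)|`, `Finset.card_vadd_finset`), in `ZMod m` with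
`m^{1/2-ε} ≤ r` and `m^{1-ε} ≤ |X c||Y c|`:
`m^{1/2-ε}·m^{1-ε} ≤ r·m^{1-ε} ≤ Σ_c |X c||Y c| ≤ K·m` (`Finset.card_nsmul_le_sum`), i.e.
`m^{1/2-2ε}·m ≤ K·m` (`Real.rpow_add`, `Real.rpow_add_one`), and `0 < m` cancels
(`le_of_mul_le_mul_right`).
-/

-- single-conjunct summit: the mandated namespace repeats `MatrixMultiplication` (summit = sub-problem).
set_option linter.dupNamespace false

namespace Summit.MatrixMultiplication.MatrixMultiplication.Theorems.PrimeTwoFamilies.LadderLift.ShapeDiversitySiegeK1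

open Finset
open scoped Pointwise

/-- **`K` sub-templates pack `K` times (one injection).**  If each `Y`-side of a ladder
`(X c, Y c)_{c < r}` in a finite abelian group `G` contains a translate `u c +ᵥ Y₀ (κ c)` of its
assigned pattern (`K` patterns `Y₀`, assignment `κ`), then `(c, x, y₀) ↦ (κ c, y₀ - x)` is
injective on `Σ_c X c ×ˢ Y₀ (κ c)` with values in `Fin K × G`, so `Σ_c |X c|·|Y₀ (κ c)| ≤ K·|G|`. -/
theorem sum_card_mul_card_subtemplate_le {G : Type*} [AddCommGroup G] [Fintype G] [DecidableEq G]
    {r K : ℕ} (X Y : Fin r → Finset G)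
    (hW : ∀ c : Fin r, ∀ x ∈ X c, ∀ x' ∈ X c, ∀ y ∈ Y c, ∀ y' ∈ Y c,
      (x - x') + (y - y') = 0 → x = x' ∧ y = y')
    (hL : ∀ c p q : Fin r, p < q → ∀ x ∈ X c, ∀ y ∈ Y c, ∀ x' ∈ X p, ∀ y' ∈ Y q, y - x ≠ y' - x')
    (Y₀ : Fin K → Finset G) (κ : Fin r → Fin K) (u : Fin r → G)
    (hY : ∀ c, u c +ᵥ Y₀ (κ c) ⊆ Y c) :
    ∑ c, (X c).card * (Y₀ (κ c)).card ≤ K * Fintype.card G := by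
  -- every translated pattern point is a point of the class
  have memY : ∀ c : Fin r, ∀ b ∈ Y₀ (κ c), u c + b ∈ Y c := fun c b hb =>
    hY c (Finset.mem_vadd_finset.2 ⟨b, hb, rfl⟩)
  -- the one map
  let f : (Σ _ : Fin r, G × G) → Fin K × G := fun z => (κ z.1, z.2.2 - z.2.1)
  have hinj : Set.InjOn f ↑((Finset.univ : Finset (Fin r)).sigma fun c => X c ×ˢ Y₀ (κ c)) := by
    rintro ⟨c, x, y⟩ hz ⟨c', x', y'⟩ hz' hzz
    simp only [Finset.coe_sigma, Finset.coe_univ, Set.mem_sigma_iff, Set.mem_univ, true_and,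
      Finset.mem_coe, Finset.mem_product] at hz hz'
    obtain ⟨hx, hy⟩ := hz
    obtain ⟨hx', hy'⟩ := hz'
    simp only [f, Prod.mk.injEq] at hzz
    obtain ⟨hk, hd⟩ := hzz
    -- `hk : κ c = κ c'`, `hd : y - x = y' - x'`
    rcases lt_trichotomy c c' with hlt | rfl | hlt
    · -- `c < c'`: diagonal pair `(x', u c' + y')` of class `c'`, cross pair `(x, u c' + y)`
      have hyc' : u c' + y ∈ Y c' := memY c' y (by rw [← hk]; exact hy)
      exact (hL c' c c' hlt x' hx' (u c' + y') (memY c' y' hy') x hx (u c' + y) hyc'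
        (by rw [add_sub_assoc, add_sub_assoc, hd])).elim
    · -- `c = c'`: directness of the class, applied to the swapped pair
      have e : (x' - x) + ((u c + y) - (u c + y')) = (y - x) - (y' - x') := by abel
      obtain ⟨hxx, hyy⟩ := hW c x' hx' x hx (u c + y) (memY c y hy) (u c + y') (memY c y' hy')
        (by rw [e, hd, sub_self])
      subst hxx
      obtain rfl : y = y' := add_left_cancel hyy
      rfl
    · -- `c' < c`: diagonal pair `(x, u c + y)` of class `c`, cross pair `(x', u c + y')`
      have hyc : u c + y' ∈ Y c := memY c y' (by rw [hk]; exact hy')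
      exact (hL c c' c hlt x hx (u c + y) (memY c y hy) x' hx' (u c + y') hyc
        (by rw [add_sub_assoc, add_sub_assoc, hd])).elim
  have h := Finset.card_le_card_of_injOn f (fun _ _ => Finset.mem_univ _) hinj
  rw [Finset.card_sigma, Finset.card_univ, Fintype.card_prod, Fintype.card_fin] at h
  calc ∑ c, (X c).card * (Y₀ (κ c)).card = ∑ c, (X c ×ˢ Y₀ (κ c)).card :=
        Finset.sum_congr rfl fun c _ => (Finset.card_product _ _).symm
    _ ≤ K * Fintype.card G := h

/-- **Shape diversity, right side** (registered stub `ladder_rpow_le_rightShapes` of crux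
`stmt-MatrixMultiplication-14308`).  A ladder level of the cyclic ladder conjecture's slice `ε` in
`ZMod m` — `m^{1/2-ε} ≤ r` classes, co-volumes `m^{1-ε} ≤ |X c||Y c|` — whose `Y`-sides are
translates of `K` templates has `m^{1/2-2ε} ≤ K`:
`m^{1/2-ε}·m^{1-ε} ≤ r·m^{1-ε} ≤ Σ_c |X c||Y c| = Σ_c |X c||Y₀ (κ c)| ≤ K·m` and `0 < m` cancels. -/
theorem ladder_rpow_le_rightShapes {m : ℕ} [NeZero m] {r K : ℕ} (X Y : Fin r → Finset (ZMod m))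
    (hW : ∀ c : Fin r, ∀ x ∈ X c, ∀ x' ∈ X c, ∀ y ∈ Y c, ∀ y' ∈ Y c,
      (x - x') + (y - y') = 0 → x = x' ∧ y = y')
    (hL : ∀ c p q : Fin r, p < q → ∀ x ∈ X c, ∀ y ∈ Y c, ∀ x' ∈ X p, ∀ y' ∈ Y q, y - x ≠ y' - x')
    (Y₀ : Fin K → Finset (ZMod m)) (κ : Fin r → Fin K) (u : Fin r → ZMod m)
    (hY : ∀ c, Y c = u c +ᵥ Y₀ (κ c))
    {ε : ℝ} (hr : (m : ℝ) ^ (1 / 2 - ε) ≤ (r : ℝ))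
    (hP : ∀ c : Fin r, (m : ℝ) ^ (1 - ε) ≤ (((X c).card * (Y c).card : ℕ) : ℝ)) :
    (m : ℝ) ^ (1 / 2 - 2 * ε) ≤ (K : ℝ) := by
  have hm : (0 : ℝ) < m := by exact_mod_cast Nat.pos_of_ne_zero (NeZero.ne m)
  -- the count `Σ_c |X c||Y c| ≤ K·m` (the `Y`-sides are the translated templates), cast to `ℝ`
  have hcount : ∑ c, (X c).card * (Y c).card ≤ K * m := by
    have h := sum_card_mul_card_subtemplate_le X Y hW hL Y₀ κ u fun c => (hY c).symm.subset
    rw [ZMod.card] at h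
    calc ∑ c, (X c).card * (Y c).card = ∑ c, (X c).card * (Y₀ (κ c)).card :=
          Finset.sum_congr rfl fun c _ => by rw [hY c, Finset.card_vadd_finset]
      _ ≤ K * m := h
  have h2 : ((∑ c, (X c).card * (Y c).card : ℕ) : ℝ) ≤ ((K * m : ℕ) : ℝ) := Nat.cast_le.2 hcount
  -- `r` terms, each at least `m^{1-ε}`
  have h1 := Finset.card_nsmul_le_sum (Finset.univ : Finset (Fin r)) _ _ fun c _ => hP c
  rw [Finset.card_univ, Fintype.card_fin, nsmul_eq_mul] at h1
  push_cast at h1 h2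
  -- `m^{1/2-ε} · m^{1-ε} ≤ r · m^{1-ε} ≤ K · m`, i.e. `m^{1/2-2ε} · m ≤ K · m`
  have h3 : (m : ℝ) ^ (1 / 2 - ε) * (m : ℝ) ^ (1 - ε) ≤ (K : ℝ) * m :=
    (mul_le_mul_of_nonneg_right hr (Real.rpow_nonneg hm.le _)).trans (h1.trans h2)
  rw [← Real.rpow_add hm, show (1 / 2 - ε + (1 - ε) : ℝ) = 1 / 2 - 2 * ε + 1 by ring,
    Real.rpow_add_one hm.ne'] at h3
  exact le_of_mul_le_mul_right h3 hm

end Summit.MatrixMultiplication.MatrixMultiplication.Theorems.PrimeTwoFamilies.LadderLift.ShapeDiversitySiegeK1
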